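import Summits.CriticalPhenomena.PercolationContinuityZ3.Theorems.Transplant.CayleySkeletonKernel
import HarnessLib

/-!
# Customers of the abstract Cayley-graph theorem that are NOT box products: `Cay(H₃(ℤ) × ℤ; S)` for generating systems MIXING the
# central `ℤ`-factor with the Heisenberg generators — `θ(p_c) = 0` unconditionally for `S₁₂ = {a, b, c, t, at, at⁻¹}^±`, and modulo the
# N1 node for the `{±1}`-only system `S₁₀ = {a, b, c, t, at}^±`

builds on p205010 (kernel theorem, internal audit signed; external expert review pending) — `twist_criticalContinuity` runs through the
closed D″ node (via `CayleySign.criticalContinuity`), whose proof uses near-one gluing (AdditiveGluing), which builds on p205010.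
Lane `prim-bschramm`, seat `prim-bschramm-p4` (gen 9; PART C3, METHOD = abstract closing argument); helper file
(`--supports stmt-CriticalPhenomena-4575 --as helper`).  Memo `HOME/bschramm/P4-GENERAL.md` §25.

THE POINT.  Every `H₃(ℤ) × ℤ` row of the lane so far is a BOX PRODUCT graph `Cay(H₃; S′) □ ℤ` (the `ℤ`-generator `t` separate).  The
abstract theorem (`CayleySkeletonSign`) does not care: here `Γ = H₃(ℤ) × ℤ` as a Mathlib `Group` on a four-coordinate structure `H3Z`
(`(x,y,c,t)·(x′,y′,c′,t′) = (x+x′, y+y′, c+c′+x y′, t+t′)`), skeleton `φ = (x, t)` (a homomorphism), reversing automorphism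
`ν = (−x, −y, c, −t)`, axis flip `κ = (x, y, c, −t)`, central translating element `z = t`, and the kernel criterion (`ker φ = ⟨b, c⟩`, both in
`S`) for connected cylinders.  For `S₁₂ = {a^±, b^±, c^±, t^±, (at)^±, (at⁻¹)^±}` — the slanted bonds `at`, `at⁻¹` make `Cay(Γ; S₁₂)` NOT a box
product with the `t`-line — all of `CayleySign` holds: **`θ_g(p_c) = 0` at every vertex, unconditionally** (`twist_criticalContinuity`).  Dropping
`(at⁻¹)^±` kills `κ` (`κ(at) = at⁻¹`) but keeps `ν`: `S₁₀` carries a `CayleyNeg`, so `θ(p_c) = 0` on `Cay(Γ; S₁₀)` modulo the N1 node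
(`chiralTwist_criticalContinuity_of_negNode₁`) — the non-abelian analogue of the 756 inversion-only unit-range `Cay(ℤ³; S)`.  §3 states the row for
EVERY admissible `S` at once (`criticalContinuity_of_gens`: `ν(S) ⊆ S`, `κ(S) ⊆ S`, `|x|,|t| ≤ 1` on `S`, `a,b,c,t ∈ S` — arbitrary `y`/`c`-components,
factor-mixing allowed): infinitely many Cayley graphs of ONE group in one kernel theorem.
* §1 the group `H3Z` (`Group` instance, coordinate lemmas, `zpow` of `b`, `c`), the automorphisms `negAut`, `flipAut`, the homomorphism `φ`;
* §2 `S₁₂`, `S₁₀`, memberships, symmetry under `ν`/`κ`, the kernel criterion `mem_closure_of_φ_eq_zero`;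
* §3 **`negOfGens` / `signOfGens` for EVERY admissible `S`**, **`criticalContinuity_of_gens`** (unconditional), `criticalContinuity_of_gens_of_negNode₁`;
* §4 **`twist : CayleySign H3Z S₁₂`**, **`twist_criticalContinuity`**; `chiralTwist : CayleyNeg H3Z S₁₀`, `chiralTwist_criticalContinuity_of_negNode₁`.
[cite: BenjaminiSchramm1996, Conj. 4; §2 (Cayley graphs)] [cite: KozmaNitzan2024, §4 p. 16 (Lemma 8)] [cite: MartineauSevero2019, Cor. 2.2]
-/

noncomputable section

namespace Summit.CriticalPhenomena.PercolationContinuityZ3.Theorems.Transplant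

open MeasureTheory Literature.Probability.Percolation Literature.Probability.LatticeModels SimpleGraph
open scoped Classical

/-! ## §1 `H₃(ℤ) × ℤ` as a Mathlib group on four coordinates -/

/-- **`H₃(ℤ) × ℤ`** on coordinates `(x, y, c, t)`: `(x,y,c)` the Heisenberg part (law `c″ = c + c′ + x y′`), `t` the central `ℤ`-factor.
[cite: BenjaminiSchramm1996, §2 (Cayley graphs)] -/
@[ext] structure H3Z where
  /-- abelianisation coordinate `x` -/
  x : ℤ
  /-- abelianisation coordinate `y` -/
  y : ℤ
  /-- central Heisenberg coordinate -/
  c : ℤ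
  /-- the `ℤ`-factor -/
  t : ℤ
deriving DecidableEq

namespace H3Z

/-- Multiplication `(x,y,c,t)·(x′,y′,c′,t′) = (x+x′, y+y′, c+c′+x y′, t+t′)`. [folklore] -/
instance : Mul H3Z := ⟨fun g h => ⟨g.x + h.x, g.y + h.y, g.c + h.c + g.x * h.y, g.t + h.t⟩⟩

/-- The identity `(0,0,0,0)`. [folklore] -/
instance : One H3Z := ⟨⟨0, 0, 0, 0⟩⟩

/-- Inversion `(x,y,c,t)⁻¹ = (−x, −y, −c + x y, −t)`. [folklore] -/
instance : Inv H3Z := ⟨fun g => ⟨-g.x, -g.y, -g.c + g.x * g.y, -g.t⟩⟩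

/-- `x`-coordinate of a product. [folklore] -/
@[simp] theorem mul_x (g h : H3Z) : (g * h).x = g.x + h.x := rfl
/-- `y`-coordinate of a product. [folklore] -/
@[simp] theorem mul_y (g h : H3Z) : (g * h).y = g.y + h.y := rfl
/-- `c`-coordinate of a product. [folklore] -/
@[simp] theorem mul_c (g h : H3Z) : (g * h).c = g.c + h.c + g.x * h.y := rfl
/-- `t`-coordinate of a product. [folklore] -/
@[simp] theorem mul_t (g h : H3Z) : (g * h).t = g.t + h.t := rfl
/-- `x`-coordinate of the identity. [folklore] -/
@[simp] theorem one_x : (1 : H3Z).x = 0 := rfl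
/-- `y`-coordinate of the identity. [folklore] -/
@[simp] theorem one_y : (1 : H3Z).y = 0 := rfl
/-- `c`-coordinate of the identity. [folklore] -/
@[simp] theorem one_c : (1 : H3Z).c = 0 := rfl
/-- `t`-coordinate of the identity. [folklore] -/
@[simp] theorem one_t : (1 : H3Z).t = 0 := rfl
/-- `x`-coordinate of an inverse. [folklore] -/
@[simp] theorem inv_x (g : H3Z) : g⁻¹.x = -g.x := rfl
/-- `y`-coordinate of an inverse. [folklore] -/
@[simp] theorem inv_y (g : H3Z) : g⁻¹.y = -g.y := rfl
/-- `c`-coordinate of an inverse. [folklore] -/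
@[simp] theorem inv_c (g : H3Z) : g⁻¹.c = -g.c + g.x * g.y := rfl
/-- `t`-coordinate of an inverse. [folklore] -/
@[simp] theorem inv_t (g : H3Z) : g⁻¹.t = -g.t := rfl

/-- **`H₃(ℤ) × ℤ` is a group.** [folklore] -/
instance : Group H3Z where
  mul_assoc a b c := by ext <;> simp <;> ring
  one_mul a := by ext <;> simp
  mul_one a := by ext <;> simp
  inv_mul_cancel a := by ext <;> simp

/-- Generator `a = (1,0,0,0)`. [folklore] -/
def gA : H3Z := ⟨1, 0, 0, 0⟩
/-- Generator `b = (0,1,0,0)`. [folklore] -/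
def gB : H3Z := ⟨0, 1, 0, 0⟩
/-- Central generator `c = (0,0,1,0)` (`= [a,b]`). [folklore] -/
def gC : H3Z := ⟨0, 0, 1, 0⟩
/-- Central generator `t = (0,0,0,1)` of the `ℤ`-factor. [folklore] -/
def gT : H3Z := ⟨0, 0, 0, 1⟩

/-- Powers of `b`: `b^k = (0,k,0,0)`. [folklore] -/
theorem gB_zpow (k : ℤ) : gB ^ k = ⟨0, k, 0, 0⟩ := by
  induction k using Int.induction_on with
  | zero => rw [zpow_zero]; rfl
  | succ n ih => rw [zpow_add_one, ih]; ext <;> simp [gB]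
  | pred n ih => rw [zpow_sub_one, ih]; (ext <;> simp [gB]); omega

/-- Powers of `c`: `c^k = (0,0,k,0)`. [folklore] -/
theorem gC_zpow (k : ℤ) : gC ^ k = ⟨0, 0, k, 0⟩ := by
  induction k using Int.induction_on with
  | zero => rw [zpow_zero]; rfl
  | succ n ih => rw [zpow_add_one, ih]; ext <;> simp [gC]
  | pred n ih => rw [zpow_sub_one, ih]; (ext <;> simp [gC]); omega

/-- `t` is central. [folklore] -/
theorem gT_central (g : H3Z) : g * gT = gT * g := by ext <;> simp [gT, add_comm]

/-- **The reversing automorphism `ν = (−x, −y, c, −t)`** (rotation by `π` of the Heisenberg part, reflection of the `ℤ`-factor).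
[cite: KozmaNitzan2024, §4 p. 16 (Lemma 8)] -/
def negAut : H3Z ≃* H3Z where
  toFun g := ⟨-g.x, -g.y, g.c, -g.t⟩
  invFun g := ⟨-g.x, -g.y, g.c, -g.t⟩
  left_inv g := by ext <;> simp
  right_inv g := by ext <;> simp
  map_mul' g h := by ext <;> simp <;> ring

/-- `ν` in coordinates. [folklore] -/
@[simp] theorem negAut_apply (g : H3Z) : negAut g = ⟨-g.x, -g.y, g.c, -g.t⟩ := rfl

/-- **The axis flip `κ = (x, y, c, −t)`** (reflection of the `ℤ`-factor alone). [cite: KozmaNitzan2024, §4 p. 16 (Lemma 8)] -/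
def flipAut : H3Z ≃* H3Z where
  toFun g := ⟨g.x, g.y, g.c, -g.t⟩
  invFun g := ⟨g.x, g.y, g.c, -g.t⟩
  left_inv g := by ext <;> simp
  right_inv g := by ext <;> simp
  map_mul' g h := by ext <;> simp [add_comm]

/-- `κ` in coordinates. [folklore] -/
@[simp] theorem flipAut_apply (g : H3Z) : flipAut g = ⟨g.x, g.y, g.c, -g.t⟩ := rfl

/-- **The skeleton homomorphism `φ = (x, t) : H₃(ℤ) × ℤ → ℤ²`.** [cite: KozmaNitzan2024, §4 p. 15 (boxes)] -/
def φ (g : H3Z) : Site 2 := ![g.x, g.t]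

/-- `φ` at coordinate `0`. [folklore] -/
@[simp] theorem φ_apply_zero (g : H3Z) : φ g 0 = g.x := rfl
/-- `φ` at coordinate `1`. [folklore] -/
@[simp] theorem φ_apply_one (g : H3Z) : φ g 1 = g.t := rfl

/-- `φ` is a homomorphism. [folklore] -/
theorem φ_mul (g h : H3Z) : φ (g * h) = φ g + φ h := by
  funext j; fin_cases j <;> simp

/-- `φ ∘ ν = −φ`. [folklore] -/
theorem φ_negAut (g : H3Z) : φ (negAut g) = -φ g := by
  funext j; fin_cases j <;> simp

/-- `φ ∘ κ = flipSnd ∘ φ`. [folklore] -/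
theorem φ_flipAut (g : H3Z) : φ (flipAut g) = flipSnd (φ g) := by
  funext j; fin_cases j <;> simp [flipSnd]

/-- `φ(t) ≠ 0`. [folklore] -/
theorem φ_gT_ne : φ gT ≠ 0 := fun h => by
  have h1 := congrFun h 1
  simp [gT] at h1

/-- `φ g = 0` means `x = 0` and `t = 0`. [folklore] -/
theorem φ_eq_zero_iff (g : H3Z) : φ g = 0 ↔ g.x = 0 ∧ g.t = 0 := by
  constructor
  · intro h; exact ⟨by simpa using congrFun h 0, by simpa using congrFun h 1⟩
  · rintro ⟨hx, ht⟩; funext j; fin_cases j <;> simp [hx, ht]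

/-! ## §2 The generating systems `S₁₂ ⊇ S₁₀` -/

/-- **`S₁₂ = {a^±, b^±, c^±, t^±, (at)^±, (at⁻¹)^±}`** — slanted bonds `at = (1,0,0,1)`, `at⁻¹ = (1,0,0,−1)` mix the factors.
[cite: BenjaminiSchramm1996, §2 (Cayley graphs)] -/
def S₁₂ : Finset H3Z :=
  {⟨1, 0, 0, 0⟩, ⟨-1, 0, 0, 0⟩, ⟨0, 1, 0, 0⟩, ⟨0, -1, 0, 0⟩, ⟨0, 0, 1, 0⟩, ⟨0, 0, -1, 0⟩, ⟨0, 0, 0, 1⟩, ⟨0, 0, 0, -1⟩,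
    ⟨1, 0, 0, 1⟩, ⟨-1, 0, 0, -1⟩, ⟨1, 0, 0, -1⟩, ⟨-1, 0, 0, 1⟩}

/-- **`S₁₀ = {a^±, b^±, c^±, t^±, (at)^±}`** — one slanted bond pair only (no axis flip preserves it). [cite: BenjaminiSchramm1996, §2] -/
def S₁₀ : Finset H3Z :=
  {⟨1, 0, 0, 0⟩, ⟨-1, 0, 0, 0⟩, ⟨0, 1, 0, 0⟩, ⟨0, -1, 0, 0⟩, ⟨0, 0, 1, 0⟩, ⟨0, 0, -1, 0⟩, ⟨0, 0, 0, 1⟩, ⟨0, 0, 0, -1⟩,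
    ⟨1, 0, 0, 1⟩, ⟨-1, 0, 0, -1⟩}

/-- `a ∈ S`, `t ∈ S` give the unit steps of `φ`, for both systems. [folklore] -/
theorem step_of_mem {S : Finset H3Z} (ha : gA ∈ S) (ht : gT ∈ S) : ∀ i : Fin 2, ∃ s ∈ S, φ s = Pi.single i 1 := by
  intro i
  fin_cases i
  · exact ⟨gA, ha, by funext j; fin_cases j <;> simp [gA]⟩
  · exact ⟨gT, ht, by funext j; fin_cases j <;> simp [gT]⟩

/-- **The kernel criterion for `φ = (x, t)`**: `ker φ = {(0, y, c, 0)} = ⟨b⟩·⟨c⟩`, so any `S ∋ b, c` generates it by height-zero generators.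
[folklore] -/
theorem mem_closure_of_φ_eq_zero {S : Finset H3Z} (hb : gB ∈ S) (hc : gC ∈ S) (g : H3Z) (hg : φ g = 0) :
    g ∈ Subgroup.closure (↑(S.filter fun s => φ s = 0) : Set H3Z) := by
  obtain ⟨hx, ht⟩ := (φ_eq_zero_iff g).1 hg
  have hb' : gB ∈ Subgroup.closure (↑(S.filter fun s => φ s = 0) : Set H3Z) :=
    Subgroup.subset_closure (Finset.mem_coe.2 (Finset.mem_filter.2 ⟨hb, (φ_eq_zero_iff _).2 ⟨rfl, rfl⟩⟩))
  have hc' : gC ∈ Subgroup.closure (↑(S.filter fun s => φ s = 0) : Set H3Z) :=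
    Subgroup.subset_closure (Finset.mem_coe.2 (Finset.mem_filter.2 ⟨hc, (φ_eq_zero_iff _).2 ⟨rfl, rfl⟩⟩))
  have e : g = gB ^ g.y * gC ^ g.c := by
    rw [gB_zpow, gC_zpow]; ext <;> simp [hx, ht]
  rw [e]
  exact Subgroup.mul_mem _ (Subgroup.zpow_mem _ hb' _) (Subgroup.zpow_mem _ hc' _)

/-- `ν` maps `S₁₂` into itself. [folklore] -/
theorem negAut_mem_S₁₂ : ∀ s ∈ S₁₂, negAut s ∈ S₁₂ := by
  intro s hs
  simp only [S₁₂, Finset.mem_insert, Finset.mem_singleton] at hs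
  rcases hs with rfl | rfl | rfl | rfl | rfl | rfl | rfl | rfl | rfl | rfl | rfl | rfl <;> decide

/-- `κ` maps `S₁₂` into itself. [folklore] -/
theorem flipAut_mem_S₁₂ : ∀ s ∈ S₁₂, flipAut s ∈ S₁₂ := by
  intro s hs
  simp only [S₁₂, Finset.mem_insert, Finset.mem_singleton] at hs
  rcases hs with rfl | rfl | rfl | rfl | rfl | rfl | rfl | rfl | rfl | rfl | rfl | rfl <;> decide

/-- `ν` maps `S₁₀` into itself. [folklore] -/
theorem negAut_mem_S₁₀ : ∀ s ∈ S₁₀, negAut s ∈ S₁₀ := by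
  intro s hs
  simp only [S₁₀, Finset.mem_insert, Finset.mem_singleton] at hs
  rcases hs with rfl | rfl | rfl | rfl | rfl | rfl | rfl | rfl | rfl | rfl <;> decide

/-- `ν` is an involution. [folklore] -/
theorem negAut_negAut (g : H3Z) : negAut (negAut g) = g := by ext <;> simp

/-- `κ` is an involution. [folklore] -/
theorem flipAut_flipAut (g : H3Z) : flipAut (flipAut g) = g := by ext <;> simp

/-- An involution mapping `S` into itself preserves `S` exactly. [folklore] -/
theorem mem_iff_of_involutive {σ : H3Z ≃* H3Z} (hσ : ∀ g, σ (σ g) = g) {S : Finset H3Z} (hS : ∀ s ∈ S, σ s ∈ S) (s : H3Z) :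
    σ s ∈ S ↔ s ∈ S :=
  ⟨fun h => by rw [← hσ s]; exact hS _ h, hS s⟩

/-! ## §3 EVERY admissible generating system of `H₃(ℤ) × ℤ` at once -/

/-- Range `≤ 1` in `x` and `t` gives `‖φ‖_∞ ≤ 1`. [folklore] -/
theorem lip_of_range {S : Finset H3Z} (h : ∀ s ∈ S, |s.x| ≤ 1 ∧ |s.t| ≤ 1) : ∀ s ∈ S, ∀ i : Fin 2, |φ s i| ≤ 1 := by
  intro s hs i
  fin_cases i
  · exact (h s hs).1
  · exact (h s hs).2

/-- **`CayleyNeg` for EVERY finite `S ⊆ H₃(ℤ) × ℤ` with `ν(S) ⊆ S`, `x`- and `t`-range `≤ 1`, and `a, b, c, t ∈ S`** (kernel criterion via `b, c`;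
`z = t`). [cite: KozmaNitzan2024, §4 p. 16 (Lemma 8)] [cite: BenjaminiSchramm1996, §2] -/
def negOfGens (S : Finset H3Z) (hν : ∀ s ∈ S, negAut s ∈ S) (hr : ∀ s ∈ S, |s.x| ≤ 1 ∧ |s.t| ≤ 1) (ha : gA ∈ S) (hb : gB ∈ S)
    (hc : gC ∈ S) (ht : gT ∈ S) : CayleyNeg H3Z S :=
  CayleyNeg.ofCentral φ φ_mul (lip_of_range hr) (step_of_mem ha ht) negAut (mem_iff_of_involutive negAut_negAut hν) φ_negAut
    (fun ℓ _ => CayleyKernel.cyl_connected_of_ker_generated φ φ_mul (step_of_mem ha ht) (mem_closure_of_φ_eq_zero hb hc) ℓ)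
    gT gT_central φ_gT_ne

/-- **`CayleySign` for every such `S` that is moreover `κ`-invariant.** [cite: KozmaNitzan2024, §4 p. 16 (Lemma 8)] -/
def signOfGens (S : Finset H3Z) (hν : ∀ s ∈ S, negAut s ∈ S) (hκ : ∀ s ∈ S, flipAut s ∈ S) (hr : ∀ s ∈ S, |s.x| ≤ 1 ∧ |s.t| ≤ 1)
    (ha : gA ∈ S) (hb : gB ∈ S) (hc : gC ∈ S) (ht : gT ∈ S) : CayleySign H3Z S where
  toCayleyNeg := negOfGens S hν hr ha hb hc ht
  κ := flipAut
  κ_mem := mem_iff_of_involutive flipAut_flipAut hκ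
  κ_φ := φ_flipAut

/-- **THEOREM (infinitely many Cayley graphs of one group, one statement): for EVERY finite `S ⊆ H₃(ℤ) × ℤ` with `ν(S) ⊆ S`, `κ(S) ⊆ S`,
`|x|, |t| ≤ 1` on `S` and `a, b, c, t ∈ S`, `θ_g(p_c) = 0` at every vertex of `Cay(H₃(ℤ) × ℤ; S)`** — unconditional.  The generators may have
arbitrary `y`- and `c`-components and may mix the factors (`at`, `abt⁻¹c⁵`, …).
builds on p205010 (kernel theorem, internal audit signed; external expert review pending). [cite: BenjaminiSchramm1996, Conj. 4; §2] -/
theorem criticalContinuity_of_gens (S : Finset H3Z) (hν : ∀ s ∈ S, negAut s ∈ S) (hκ : ∀ s ∈ S, flipAut s ∈ S)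
    (hr : ∀ s ∈ S, |s.x| ≤ 1 ∧ |s.t| ≤ 1) (ha : gA ∈ S) (hb : gB ∈ S) (hc : gC ∈ S) (ht : gT ∈ S) (g : H3Z) :
    theta (mulCayley (S : Set H3Z)) g (criticalProbIOf (mulCayley (S : Set H3Z)) g) = 0 :=
  (signOfGens S hν hκ hr ha hb hc ht).criticalContinuity g

/-- **CONDITIONAL THEOREM (N1): the same without `κ`-invariance**, modulo `SamePDropOfSkeletonNeg₁`. [cite: BenjaminiSchramm1996, Conj. 4; §2] -/
theorem criticalContinuity_of_gens_of_negNode₁ (hD : SamePDropOfSkeletonNeg₁) (S : Finset H3Z) (hν : ∀ s ∈ S, negAut s ∈ S)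
    (hr : ∀ s ∈ S, |s.x| ≤ 1 ∧ |s.t| ≤ 1) (ha : gA ∈ S) (hb : gB ∈ S) (hc : gC ∈ S) (ht : gT ∈ S) (g : H3Z) :
    theta (mulCayley (S : Set H3Z)) g (criticalProbIOf (mulCayley (S : Set H3Z)) g) = 0 :=
  (negOfGens S hν hr ha hb hc ht).criticalContinuity_of_negNode₁ hD g

/-! ## §4 The instances `S₁₂` (unconditional) and `S₁₀` (`{±1}` only) -/

/-- Ranges of `S₁₂`. [folklore] -/
theorem range_S₁₂ : ∀ s ∈ S₁₂, |s.x| ≤ 1 ∧ |s.t| ≤ 1 := by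
  intro s hs
  simp only [S₁₂, Finset.mem_insert, Finset.mem_singleton] at hs
  rcases hs with rfl | rfl | rfl | rfl | rfl | rfl | rfl | rfl | rfl | rfl | rfl | rfl <;> decide

/-- Ranges of `S₁₀`. [folklore] -/
theorem range_S₁₀ : ∀ s ∈ S₁₀, |s.x| ≤ 1 ∧ |s.t| ≤ 1 := by
  intro s hs
  simp only [S₁₀, Finset.mem_insert, Finset.mem_singleton] at hs
  rcases hs with rfl | rfl | rfl | rfl | rfl | rfl | rfl | rfl | rfl | rfl <;> decide

/-- **`Cay(H₃(ℤ) × ℤ; S₁₂)` carries a `CayleySign`.** [cite: KozmaNitzan2024, §4 p. 16 (Lemma 8)] [cite: BenjaminiSchramm1996, §2] -/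
def twist : CayleySign H3Z S₁₂ :=
  signOfGens S₁₂ negAut_mem_S₁₂ flipAut_mem_S₁₂ range_S₁₂ (by simp [S₁₂, gA]) (by simp [S₁₂, gB]) (by simp [S₁₂, gC]) (by simp [S₁₂, gT])

/-- **THEOREM: `θ_g(p_c) = 0` at every vertex of `Cay(H₃(ℤ) × ℤ; S₁₂)`** — a Cayley graph of `H₃(ℤ) × ℤ` that is not a box product
with the `t`-line; unconditional (closed D″ node).  builds on p205010 (kernel theorem, internal audit signed; external expert review pending).
[cite: BenjaminiSchramm1996, Conj. 4; §2] -/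
theorem twist_criticalContinuity (g : H3Z) :
    theta (mulCayley (S₁₂ : Set H3Z)) g (criticalProbIOf (mulCayley (S₁₂ : Set H3Z)) g) = 0 :=
  twist.criticalContinuity g

/-- **`Cay(H₃(ℤ) × ℤ; S₁₀)` carries a `CayleyNeg`** (no axis flip preserves `S₁₀`: `κ(at) = at⁻¹ ∉ S₁₀`). [cite: KozmaNitzan2024, §4 p. 16 (Lemma 8)] -/
def chiralTwist : CayleyNeg H3Z S₁₀ :=
  negOfGens S₁₀ negAut_mem_S₁₀ range_S₁₀ (by simp [S₁₀, gA]) (by simp [S₁₀, gB]) (by simp [S₁₀, gC]) (by simp [S₁₀, gT])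

/-- **CONDITIONAL THEOREM: `θ_g(p_c) = 0` at every vertex of `Cay(H₃(ℤ) × ℤ; S₁₀)`, modulo `SamePDropOfSkeletonNeg₁`.**
[cite: BenjaminiSchramm1996, Conj. 4; §2] -/
theorem chiralTwist_criticalContinuity_of_negNode₁ (hD : SamePDropOfSkeletonNeg₁) (g : H3Z) :
    theta (mulCayley (S₁₀ : Set H3Z)) g (criticalProbIOf (mulCayley (S₁₀ : Set H3Z)) g) = 0 :=
  chiralTwist.criticalContinuity_of_negNode₁ hD g

/-- `κ` does NOT preserve `S₁₀` (the datum for `CayleySign` is absent for this system in the obvious gauge). [folklore] -/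
theorem flipAut_not_mem_S₁₀ : flipAut ⟨1, 0, 0, 1⟩ ∉ S₁₀ := by decide

end H3Z

end Summit.CriticalPhenomena.PercolationContinuityZ3.Theorems.Transplant

end
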